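import Literature.Topology.FourManifolds.TautFoliationsContourSectors
import Literature.Topology.FourManifolds.TautFoliationsEdgeChartSides
import Literature.Topology.FourManifolds.TautFoliationsGridEdges
import Literature.Topology.PlanarFoliations.OfCharts
import HarnessLib

/-!
# The contour foliation of a checkerboard cone datum on a square grid

Topic: assembly of `TautFoliationsContourSectors`, `TautFoliationsEdgeChartSides`,
`TautFoliationsGridEdges` and `PlanarFoliations.OfCharts`. A **checkerboard datum** on a grid
`g` consists of apex heights `m q`, boundary heights `ψ q` (continuous on `∂Q`), a roof/floor
pattern with `ψ q < m q` on roof squares and `m q < ψ q` on floor squares, opposite on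
edge-neighbours, and increasing conversions `σ q q' : ℝ ≃o ℝ` with `ψ q = σ q q' ∘ ψ q'` on the
common edge of a roof square `q` and a floor neighbour `q'`. Its **contour foliation** lives on
the open big square minus the centres and the vertices,
`X₀ = ball bigCentre (n ℓ) ∖ (centres ∪ vertices)`:

* `CheckerboardDatum g` (**definition**), `Grid.EdgeNb` (edge-neighbours);
* `CheckerboardDatum.X₀` (**definition**, an `Opens (ℝ × ℝ)`, nonempty);
* `CheckerboardDatum.IsPlaneChart` (**definition**): the sector charts of the squares (roof or
  floor, four rotations) and the edge charts of the (roof, floor) edge-neighbour pairs;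
* `CheckerboardDatum.preAtlas` (**definition**, axioms **proved**): their restrictions to `X₀`
  form a `PreAtlas` — cover by the classification of grid points, monotone transitions because
  near a point of an open square every chart height is an increasing function of the cone
  height of that square (`rep`), and at an open-edge point only the edge chart of that edge is
  present, with its canonical glued height (`canonHt`);
* `CheckerboardDatum.foliation` (**definition**): the induced `Foliation ℝ X₀`, transversely
  oriented (`isTransverselyOriented_foliation`).

All statements are [folklore].
-/

noncomputable section

open Set Filter Metric Topology
open Literature.Topology.PlanarFoliations

namespace Literature.Topology.FourManifolds

open ConeSquare SquareGrid

namespace ConeSquare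

/-! ## Open edges: symmetry and the vertical standard position -/

/-- The open edge is symmetric in the two centres. [folklore] -/
theorem openEdge_comm (a b : ℝ × ℝ) (ℓ : ℝ) : openEdge a b ℓ = openEdge b a ℓ := by
  ext y
  simp only [openEdge, mem_setOf_eq]
  have : a + (1 / 2 : ℝ) • (b - a) = b + (1 / 2 : ℝ) • (a - b) := by
    ext <;> simp only [Prod.fst_add, Prod.smul_fst, Prod.fst_sub, Prod.snd_add, Prod.smul_snd, Prod.snd_sub,
      smul_eq_mul] <;> ring
  rw [this]; tauto

/-- In vertical standard position the open edge is the open top edge. [folklore] -/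
theorem mem_openEdge_top_iff {c : ℝ × ℝ} {ℓ : ℝ} (hℓ : 0 < ℓ) {y : ℝ × ℝ} :
    y ∈ openEdge c (c.1, c.2 + 2 * ℓ) ℓ ↔ y.2 = c.2 + ℓ ∧ |y.1 - c.1| < ℓ := by
  have hmid : c + (1 / 2 : ℝ) • ((c.1, c.2 + 2 * ℓ) - c) = (c.1, c.2 + ℓ) := by
    ext <;> simp only [Prod.smul_fst, Prod.smul_snd, Prod.fst_add, Prod.snd_add, Prod.fst_sub, Prod.snd_sub, smul_eq_mul] <;> ring
  constructor
  · rintro ⟨h1, h2, h3⟩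
    rw [mem_sphere, Prod.dist_eq, Real.dist_eq, Real.dist_eq] at h1 h2
    simp only at h2
    have e1 := le_max_right |y.1 - c.1| |y.2 - c.2|
    rw [h1] at e1
    have e2 := le_max_right |y.1 - c.1| |y.2 - (c.2 + 2 * ℓ)|
    rw [h2] at e2
    rw [abs_le] at e1 e2
    have hy2 : y.2 = c.2 + ℓ := by linarith
    refine ⟨hy2, ?_⟩
    rw [hmid, Prod.dist_eq, Real.dist_eq, Real.dist_eq, hy2] at h3
    simp only [sub_self, abs_zero] at h3
    exact lt_of_le_of_lt (le_max_left _ _) h3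
  · rintro ⟨h1, h2⟩
    refine ⟨?_, ?_, ?_⟩
    · rw [mem_sphere, Prod.dist_eq, Real.dist_eq, Real.dist_eq, h1, show c.2 + ℓ - c.2 = ℓ by ring, abs_of_pos hℓ]
      exact max_eq_right h2.le
    · rw [mem_sphere, Prod.dist_eq, Real.dist_eq, Real.dist_eq, h1]
      simp only
      rw [show c.2 + ℓ - (c.2 + 2 * ℓ) = -ℓ by ring, abs_neg, abs_of_pos hℓ]
      exact max_eq_right h2.le
    · rw [hmid, Prod.dist_eq, Real.dist_eq, Real.dist_eq, h1]
      simp only [sub_self, abs_zero]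
      exact max_lt h2 hℓ

end ConeSquare

namespace SquareGrid.Grid

variable (g : Grid)

/-- Edge-neighbours (in either order, horizontally or vertically). [folklore] -/
def EdgeNb (q q' : Fin g.n × Fin g.n) : Prop := g.rightNb q q' ∨ g.rightNb q' q ∨ g.topNb q q' ∨ g.topNb q' q

/-- Edge-neighbourhood is symmetric. [folklore] -/
theorem EdgeNb.symm {g : Grid} {q q' : Fin g.n × Fin g.n} (h : g.EdgeNb q q') : g.EdgeNb q' q := by
  rcases h with h | h | h | h
  exacts [Or.inr (Or.inl h), Or.inl h, Or.inr (Or.inr (Or.inr h)), Or.inr (Or.inr (Or.inl h))]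

/-- The centre of an edge-neighbour is one of the four translates. [folklore] -/
theorem centre_of_edgeNb {q q' : Fin g.n × Fin g.n} (h : g.EdgeNb q q') :
    g.centre q' = ((g.centre q).1 + 2 * g.ℓ, (g.centre q).2) ∨ g.centre q' = ((g.centre q).1, (g.centre q).2 + 2 * g.ℓ) ∨
      g.centre q' = ((g.centre q).1 - 2 * g.ℓ, (g.centre q).2) ∨ g.centre q' = ((g.centre q).1, (g.centre q).2 - 2 * g.ℓ) := by
  rcases h with h | h | h | h
  · exact Or.inl (g.centre_rightNb h)
  · right; right; left
    have := g.centre_rightNb h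
    rw [this]; ext <;> simp
  · exact Or.inr (Or.inl (g.centre_topNb h))
  · right; right; right
    have := g.centre_topNb h
    rw [this]; ext <;> simp


/-! ### The carrier -/

/-- **The carrier `X₀`**: the open big square minus the centres and the vertices. [folklore] -/
def X₀ : TopologicalSpace.Opens (ℝ × ℝ) :=
  ⟨ball g.bigCentre (g.n * g.ℓ) ∩ (g.centres ∪ g.vertices)ᶜ,
    isOpen_ball.inter (g.finite_centres.union g.finite_vertices).isClosed.isOpen_compl⟩

/-- Membership in the carrier. [folklore] -/
theorem mem_X₀_iff {x : ℝ × ℝ} : x ∈ g.X₀ ↔ x ∈ ball g.bigCentre (g.n * g.ℓ) ∧ x ∉ g.centres ∧ x ∉ g.vertices := by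
  show x ∈ ball g.bigCentre (g.n * g.ℓ) ∩ (g.centres ∪ g.vertices)ᶜ ↔ _
  rw [mem_inter_iff, mem_compl_iff, mem_union, not_or]

/-- **The carrier is nonempty** (the point `centre (0,0) + (ℓ/2, 0)`). [folklore] -/
theorem nonempty_X₀ : Nonempty g.X₀ := by
  have hℓ := g.hℓ
  have hn := g.hn
  set q₀ : Fin g.n × Fin g.n := (⟨0, hn⟩, ⟨0, hn⟩) with hq₀
  set p : ℝ × ℝ := ((g.centre q₀).1 + g.ℓ / 2, (g.centre q₀).2) with hp
  have hc1 : (g.centre q₀).1 = g.a.1 + g.ℓ := by rw [Grid.centre_fst]; simp [hq₀]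
  have hc2 : (g.centre q₀).2 = g.a.2 + g.ℓ := by rw [Grid.centre_snd]; simp [hq₀]
  have hn1 : (1 : ℝ) ≤ g.n := by exact_mod_cast hn
  refine ⟨⟨p, (g.mem_X₀_iff).2 ⟨?_, ?_, ?_⟩⟩⟩
  · rw [Grid.mem_ball_bigCentre_iff, hp]
    simp only
    rw [hc1, hc2]
    refine ⟨by linarith, ?_, by linarith, ?_⟩ <;> nlinarith
  · rintro ⟨q, hq⟩
    have h1 := congrArg Prod.fst hq
    rw [Grid.centre_fst, hp] at h1
    simp only at h1
    rw [hc1] at h1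
    -- `(2 q.1 + 1) ℓ = ℓ + ℓ/2`: impossible for an integer
    have h2 : (2 * ((q.1 : ℕ) : ℝ) + 1) * g.ℓ = (3 / 2) * g.ℓ := by linarith
    have h3 : (2 * ((q.1 : ℕ) : ℝ) + 1) = 3 / 2 := mul_right_cancel₀ hℓ.ne' h2
    have h4 : (4 * (q.1 : ℕ) + 2 : ℝ) = 3 := by linarith
    have h5 : (4 * (q.1 : ℕ) + 2 : ℕ) = 3 := by exact_mod_cast h4
    omega
  · rintro ⟨pq, -, hq⟩
    have h1 := congrArg Prod.fst hq
    rw [hp] at h1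
    simp only at h1
    rw [hc1] at h1
    have h2 : (2 * ((pq.1 : ℕ) : ℝ)) * g.ℓ = (3 / 2) * g.ℓ := by linarith
    have h3 : (2 * ((pq.1 : ℕ) : ℝ)) = 3 / 2 := mul_right_cancel₀ hℓ.ne' h2
    have h4 : (4 * (pq.1 : ℕ) : ℝ) = 3 := by linarith
    have h5 : (4 * (pq.1 : ℕ) : ℕ) = 3 := by exact_mod_cast h4
    omega

/-- The `k`-fold rotation symmetry of the square `q`. [folklore] -/
def rotSym (q : Fin g.n × Fin g.n) (k : ℕ) : (ℝ × ℝ) ≃ₜ (ℝ × ℝ) :=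
  Nat.iterate (fun S : (ℝ × ℝ) ≃ₜ (ℝ × ℝ) ↦ S.trans (ConeSquare.rot (g.centre q))) k (Homeomorph.refl _)

/-! ### Open squares: which square -/

/-- A point of the open square of `q₁` in the closed square of `q` forces `q₁ = q`. [folklore] -/
theorem eq_of_mem_ball_of_mem_ball {q q₁ : Fin g.n × Fin g.n} {y : ℝ × ℝ} (hy : y ∈ ball (g.centre q) g.ℓ)
    (hy₁ : y ∈ ball (g.centre q₁) g.ℓ) : q₁ = q := by
  by_contra hne
  exact disjoint_left.1 (g.ball_disjoint_sq hne) hy₁ (ball_subset_closedBall hy)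

/-- A point of an open edge is in no open square. [folklore] -/
theorem not_mem_ball_of_mem_openEdge {q q' q₁ : Fin g.n × Fin g.n} {y : ℝ × ℝ}
    (hy : y ∈ openEdge (g.centre q) (g.centre q') g.ℓ) : y ∉ ball (g.centre q₁) g.ℓ := by
  intro hb
  by_cases h : q₁ = q
  · subst h
    have := hy.1; rw [mem_sphere] at this; rw [mem_ball] at hb; exact absurd this (ne_of_lt hb)
  · exact disjoint_left.1 (g.ball_disjoint_sq h) hb (g.sphere_subset_sq q hy.1)

/-! ### Open edges in grid terms -/

/-- The open edge of a right-neighbour pair is the open right edge. [folklore] -/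
theorem openEdge_eq_openRightEdge {q q' : Fin g.n × Fin g.n} (h : g.rightNb q q') :
    openEdge (g.centre q) (g.centre q') g.ℓ = g.openRightEdge q := by
  ext y
  have : g.centre q' = rightCenter (g.centre q) g.ℓ := by rw [g.centre_rightNb h]; rfl
  rw [this, mem_openEdge_std_iff g.hℓ]
  rfl

/-- The open edge of a top-neighbour pair is the open top edge. [folklore] -/
theorem openEdge_eq_openTopEdge {q q' : Fin g.n × Fin g.n} (h : g.topNb q q') :
    openEdge (g.centre q) (g.centre q') g.ℓ = g.openTopEdge q := by
  ext y
  rw [g.centre_topNb h, mem_openEdge_top_iff g.hℓ]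
  rfl


end SquareGrid.Grid

/-! ## Checkerboard data -/

/-- **A checkerboard cone datum on a grid.** [folklore] -/
structure CheckerboardDatum (g : Grid) where
  /-- apex heights [folklore] -/
  m : Fin g.n × Fin g.n → ℝ
  /-- boundary heights [folklore] -/
  ψ : Fin g.n × Fin g.n → ℝ × ℝ → ℝ
  /-- roof squares [folklore] -/
  roof : Fin g.n × Fin g.n → Prop
  /-- height conversions from the floor neighbour `q'` to the roof square `q` [folklore] -/
  σ : Fin g.n × Fin g.n → Fin g.n × Fin g.n → ℝ ≃o ℝ
  /-- boundary heights are continuous [folklore] -/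
  cont : ∀ q, ContinuousOn (ψ q) (sphere (g.centre q) g.ℓ)
  /-- roof squares: boundary below the apex [folklore] -/
  lt_apex : ∀ q, roof q → ∀ y ∈ sphere (g.centre q) g.ℓ, ψ q y < m q
  /-- floor squares: boundary above the apex [folklore] -/
  apex_lt : ∀ q, ¬ roof q → ∀ y ∈ sphere (g.centre q) g.ℓ, m q < ψ q y
  /-- checkerboard pattern [folklore] -/
  checker : ∀ q q', g.EdgeNb q q' → (roof q ↔ ¬ roof q')
  /-- compatibility of boundary heights on common edges [folklore] -/
  compat : ∀ q q', g.EdgeNb q q' → roof q → ¬ roof q' →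
    ∀ y ∈ sphere (g.centre q) g.ℓ ∩ sphere (g.centre q') g.ℓ, ψ q y = σ q q' (ψ q' y)

namespace CheckerboardDatum

variable {g : Grid} (D : CheckerboardDatum g)

/-- The cone height of the square `q`. [folklore] -/
def H (q : Fin g.n × Fin g.n) (y : ℝ × ℝ) : ℝ := coneHt (g.centre q) g.ℓ (D.m q) (D.ψ q) y

/-! ### The plane charts -/

/-- The roof sector chart of `q` for the `k`-th rotation. [folklore] -/
def roofChart (q : Fin g.n × Fin g.n) (h : D.roof q) (k : ℕ) : OpenPartialHomeomorph (ℝ × ℝ) (ℝ × ℝ) :=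
  sectorChart (g.centre q) g.ℓ (D.m q) (D.ψ q) g.hℓ (D.lt_apex q h) (D.cont q) (g.rotSym q k)
    (isSquareSymmetry_rot_iterate (g.centre q) g.ℓ k)

/-- The floor sector chart of `q` for the `k`-th rotation. [folklore] -/
def floorChart (q : Fin g.n × Fin g.n) (h : ¬ D.roof q) (k : ℕ) : OpenPartialHomeomorph (ℝ × ℝ) (ℝ × ℝ) :=
  floorSectorChart (g.centre q) g.ℓ (D.m q) (D.ψ q) g.hℓ (D.apex_lt q h) (D.cont q) (g.rotSym q k)
    (isSquareSymmetry_rot_iterate (g.centre q) g.ℓ k)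

/-- The edge data type of the pair `(q, q')` with motion `T`. [folklore] -/
abbrev EData (q q' : Fin g.n × Fin g.n) (T : (ℝ × ℝ) ≃ₜ (ℝ × ℝ)) : Prop :=
  EdgeDataAt (g.centre q) (g.centre q') g.ℓ (D.m q) (D.m q') (D.ψ q) (D.ψ q') (D.σ q q') T

/-- **The plane charts of the datum.** [folklore] -/
def IsPlaneChart (c : OpenPartialHomeomorph (ℝ × ℝ) (ℝ × ℝ)) : Prop :=
  (∃ q, ∃ h : D.roof q, ∃ k : ℕ, c = D.roofChart q h k) ∨
  (∃ q, ∃ h : ¬ D.roof q, ∃ k : ℕ, c = D.floorChart q h k) ∨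
  (∃ q q', ∃ T : (ℝ × ℝ) ≃ₜ (ℝ × ℝ), g.EdgeNb q q' ∧ D.roof q ∧ ¬ D.roof q' ∧ ∃ E : D.EData q q' T, c = E.chart)

/-- Roof charts read the cone height. [folklore] -/
theorem roofChart_snd {q : Fin g.n × Fin g.n} (h : D.roof q) (k : ℕ) (y : ℝ × ℝ) : (D.roofChart q h k y).2 = D.H q y :=
  sectorChart_snd _ _ _ _ y

/-- Floor charts read the cone height. [folklore] -/
theorem floorChart_snd {q : Fin g.n × Fin g.n} (h : ¬ D.roof q) (k : ℕ) (y : ℝ × ℝ) : (D.floorChart q h k y).2 = D.H q y :=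
  floorSectorChart_snd _ _ _ _ y

/-- Roof chart sources lie in the open square. [folklore] -/
theorem roofChart_source_subset {q : Fin g.n × Fin g.n} (h : D.roof q) (k : ℕ) :
    (D.roofChart q h k).source ⊆ ball (g.centre q) g.ℓ := fun _ hy ↦
  ((mem_sectorChart_source_iff _ _ _ _).1 hy).1

/-- Floor chart sources lie in the open square. [folklore] -/
theorem floorChart_source_subset {q : Fin g.n × Fin g.n} (h : ¬ D.roof q) (k : ℕ) :
    (D.floorChart q h k).source ⊆ ball (g.centre q) g.ℓ := by
  intro y hy
  rw [floorChart, floorSectorChart_source] at hy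
  exact (isSquareSymmetry_rot_iterate (g.centre q) g.ℓ k).mem_ball_iff.1 hy.1

/-! ### Existence of edge data for (roof, floor) edge-neighbours -/

/-- **Edge data exist for every (roof, floor) pair of edge-neighbours.** [folklore] -/
theorem exists_eData {q q' : Fin g.n × Fin g.n} (hn : g.EdgeNb q q') (hr : D.roof q) (hf : ¬ D.roof q') :
    ∃ T, D.EData q q' T := by
  obtain ⟨T, hT, -, hTb⟩ := exists_motion_of_adjacent (g.centre q) g.ℓ (g.centre q') (g.centre_of_edgeNb hn)
  exact ⟨T, ⟨g.hℓ, D.lt_apex q hr, D.apex_lt q' hf, D.cont q, D.cont q', D.compat q q' hn hr hf, hT, hTb⟩⟩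

/-! ### Representation of the chart heights on open squares -/

/-- **On the open square of `q`, every plane chart height is a strictly increasing function of
the cone height of `q`.** [folklore] -/
theorem rep {c : OpenPartialHomeomorph (ℝ × ℝ) (ℝ × ℝ)} (hc : D.IsPlaneChart c) (q : Fin g.n × Fin g.n) :
    ∃ φ : ℝ → ℝ, StrictMono φ ∧ ∀ y ∈ c.source ∩ ball (g.centre q) g.ℓ, (c y).2 = φ (D.H q y) := by
  classical
  rcases hc with ⟨q₁, h, k, rfl⟩ | ⟨q₁, h, k, rfl⟩ | ⟨q₁, q₂, T, hn, hr, hf, E, rfl⟩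
  · refine ⟨id, strictMono_id, fun y hy ↦ ?_⟩
    have := g.eq_of_mem_ball_of_mem_ball hy.2 (D.roofChart_source_subset h k hy.1)
    subst this
    exact D.roofChart_snd h k y
  · refine ⟨id, strictMono_id, fun y hy ↦ ?_⟩
    have := g.eq_of_mem_ball_of_mem_ball hy.2 (D.floorChart_source_subset h k hy.1)
    subst this
    exact D.floorChart_snd h k y
  · by_cases hq : q = q₂
    · subst hq
      refine ⟨D.σ q₁ q, (D.σ q₁ q).strictMono, fun y hy ↦ E.chart_snd_of_mem_ball_right hy.2⟩
    · refine ⟨id, strictMono_id, fun y hy ↦ ?_⟩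
      rcases E.source_subset hy.1 with (hb | hb) | he
      · have := g.eq_of_mem_ball_of_mem_ball hy.2 hb
        subst this
        exact E.chart_snd_of_mem_ball_left hb
      · exact absurd (g.eq_of_mem_ball_of_mem_ball hy.2 hb) (Ne.symm hq)
      · exact absurd hy.2 (g.not_mem_ball_of_mem_openEdge he)

/-- **Off the open squares, a plane chart containing the point is an edge chart whose open
edge contains it.** [folklore] -/
theorem edge_of_not_mem_ball {c : OpenPartialHomeomorph (ℝ × ℝ) (ℝ × ℝ)} (hc : D.IsPlaneChart c) {y : ℝ × ℝ}
    (hy : y ∈ c.source) (hnot : ∀ q, y ∉ ball (g.centre q) g.ℓ) :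
    ∃ q q' T, g.EdgeNb q q' ∧ D.roof q ∧ ¬ D.roof q' ∧ ∃ E : D.EData q q' T, c = E.chart ∧
      y ∈ openEdge (g.centre q) (g.centre q') g.ℓ := by
  rcases hc with ⟨q₁, h, k, rfl⟩ | ⟨q₁, h, k, rfl⟩ | ⟨q₁, q₂, T, hn, hr, hf, E, rfl⟩
  · exact absurd (D.roofChart_source_subset h k hy) (hnot q₁)
  · exact absurd (D.floorChart_source_subset h k hy) (hnot q₁)
  · refine ⟨q₁, q₂, T, hn, hr, hf, E, rfl, ?_⟩
    rcases E.source_subset hy with (hb | hb) | he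
    · exact absurd hb (hnot q₁)
    · exact absurd hb (hnot q₂)
    · exact he

/-- **The (roof, floor) pair of edge-neighbours through an open-edge point is unique.**
[folklore] -/
theorem pair_unique {q₁ q₂ q₃ q₄ : Fin g.n × Fin g.n} {y : ℝ × ℝ}
    (h₁₂ : g.EdgeNb q₁ q₂) (h₃₄ : g.EdgeNb q₃ q₄) (hr₁ : D.roof q₁) (hf₄ : ¬ D.roof q₄)
    (hy₁ : y ∈ openEdge (g.centre q₁) (g.centre q₂) g.ℓ) (hy₃ : y ∈ openEdge (g.centre q₃) (g.centre q₄) g.ℓ) :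
    q₁ = q₃ ∧ q₂ = q₄ := by
  -- the unordered pairs coincide: reduce every case to right/top edges of a determined square
  have key : ∀ {p p' r r' : Fin g.n × Fin g.n}, g.EdgeNb p p' → g.EdgeNb r r' →
      y ∈ openEdge (g.centre p) (g.centre p') g.ℓ → y ∈ openEdge (g.centre r) (g.centre r') g.ℓ →
      (p = r ∧ p' = r') ∨ (p = r' ∧ p' = r) := by
    intro p p' r r' hp hr hyp hyr
    -- normal forms: (square s, direction, other square s') with openEdge = openRightEdge s or openTopEdge s
    have nf : ∀ {s s' : Fin g.n × Fin g.n}, g.EdgeNb s s' → y ∈ openEdge (g.centre s) (g.centre s') g.ℓ →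
        (∃ t t', ((s = t ∧ s' = t') ∨ (s = t' ∧ s' = t)) ∧ g.rightNb t t' ∧ y ∈ g.openRightEdge t) ∨
        (∃ t t', ((s = t ∧ s' = t') ∨ (s = t' ∧ s' = t)) ∧ g.topNb t t' ∧ y ∈ g.openTopEdge t) := by
      intro s s' hs hys
      rcases hs with h | h | h | h
      · exact Or.inl ⟨s, s', Or.inl ⟨rfl, rfl⟩, h, by rwa [g.openEdge_eq_openRightEdge h] at hys⟩
      · refine Or.inl ⟨s', s, Or.inr ⟨rfl, rfl⟩, h, ?_⟩
        rwa [openEdge_comm, g.openEdge_eq_openRightEdge h] at hys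
      · exact Or.inr ⟨s, s', Or.inl ⟨rfl, rfl⟩, h, by rwa [g.openEdge_eq_openTopEdge h] at hys⟩
      · refine Or.inr ⟨s', s, Or.inr ⟨rfl, rfl⟩, h, ?_⟩
        rwa [openEdge_comm, g.openEdge_eq_openTopEdge h] at hys
    have uniqR : ∀ {t t' u u' : Fin g.n × Fin g.n}, g.rightNb t t' → g.rightNb u u' → y ∈ g.openRightEdge t →
        y ∈ g.openRightEdge u → t = u ∧ t' = u' := by
      intro t t' u u' ht hu hyt hyu
      have e := g.eq_of_mem_openRightEdge hyt hyu
      subst e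
      refine ⟨rfl, Prod.ext (Fin.ext (by have := ht.1; have := hu.1; omega)) (by rw [ht.2, hu.2])⟩
    have uniqT : ∀ {t t' u u' : Fin g.n × Fin g.n}, g.topNb t t' → g.topNb u u' → y ∈ g.openTopEdge t →
        y ∈ g.openTopEdge u → t = u ∧ t' = u' := by
      intro t t' u u' ht hu hyt hyu
      have e := g.eq_of_mem_openTopEdge hyt hyu
      subst e
      refine ⟨rfl, Prod.ext (by rw [ht.1, hu.1]) (Fin.ext (by have := ht.2; have := hu.2; omega))⟩
    rcases nf hp hyp with ⟨t, t', ht, htt, hyt⟩ | ⟨t, t', ht, htt, hyt⟩ <;>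
      rcases nf hr hyr with ⟨u, u', hu, huu, hyu⟩ | ⟨u, u', hu, huu, hyu⟩
    · obtain ⟨e1, e2⟩ := uniqR htt huu hyt hyu
      subst e1; subst e2
      rcases ht with ⟨rfl, rfl⟩ | ⟨rfl, rfl⟩ <;> rcases hu with ⟨rfl, rfl⟩ | ⟨rfl, rfl⟩
      exacts [Or.inl ⟨rfl, rfl⟩, Or.inr ⟨rfl, rfl⟩, Or.inr ⟨rfl, rfl⟩, Or.inl ⟨rfl, rfl⟩]
    · exact absurd hyu (disjoint_left.1 (g.openRightEdge_disjoint_openTopEdge t u) hyt)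
    · exact absurd hyt (disjoint_left.1 (g.openRightEdge_disjoint_openTopEdge u t) hyu)
    · obtain ⟨e1, e2⟩ := uniqT htt huu hyt hyu
      subst e1; subst e2
      rcases ht with ⟨rfl, rfl⟩ | ⟨rfl, rfl⟩ <;> rcases hu with ⟨rfl, rfl⟩ | ⟨rfl, rfl⟩
      exacts [Or.inl ⟨rfl, rfl⟩, Or.inr ⟨rfl, rfl⟩, Or.inr ⟨rfl, rfl⟩, Or.inl ⟨rfl, rfl⟩]
  rcases key h₁₂ h₃₄ hy₁ hy₃ with ⟨e1, e2⟩ | ⟨e1, e2⟩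
  · exact ⟨e1, e2⟩
  · subst e1; subst e2; exact absurd hr₁ hf₄

/-! ### The pre-atlas on the carrier -/

/-- The charts of the carrier: restrictions of the plane charts. [folklore] -/
def charts : Set (OpenPartialHomeomorph g.X₀ (ℝ × ℝ)) :=
  {c | ∃ ĉ, D.IsPlaneChart ĉ ∧ c = @OpenPartialHomeomorph.subtypeRestr _ _ _ _ ĉ g.X₀ g.nonempty_X₀}

/-- **Cover**: every point of the carrier lies in the source of a chart. [folklore] -/
theorem cover (x : g.X₀) : ∃ c ∈ D.charts, x ∈ c.source := by
  classical
  haveI := g.nonempty_X₀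
  obtain ⟨hxb, hxc, hxv⟩ := (g.mem_X₀_iff).1 x.2
  -- a plane chart containing `x`
  suffices h : ∃ ĉ, D.IsPlaneChart ĉ ∧ (x : ℝ × ℝ) ∈ ĉ.source by
    obtain ⟨ĉ, hĉ, hx⟩ := h
    refine ⟨ĉ.subtypeRestr g.nonempty_X₀, ⟨ĉ, hĉ, rfl⟩, ?_⟩
    rw [OpenPartialHomeomorph.subtypeRestr_source]; exact hx
  rcases g.mem_ball_or_edge_or_vertex hxb with ⟨q, hq⟩ | ⟨q, hqn, hx1, hx2⟩ | ⟨q, hqn, hx1, hx2⟩ | hv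
  · -- open square, off the centre
    have hxq : (x : ℝ × ℝ) ≠ g.centre q := fun h ↦ hxc ⟨q, h.symm⟩
    by_cases hr : D.roof q
    · obtain ⟨k, -, hk⟩ := exists_mem_sectorChart_source g.hℓ (D.lt_apex q hr) (D.cont q) hq hxq
      exact ⟨_, Or.inl ⟨q, hr, k, rfl⟩, hk⟩
    · obtain ⟨k, -, hk⟩ := exists_mem_floorSectorChart_source g.hℓ (D.apex_lt q hr) (D.cont q) hq hxq
      exact ⟨_, Or.inr (Or.inl ⟨q, hr, k, rfl⟩), hk⟩
  · -- open right edge of `q`, right neighbour `q'`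
    obtain ⟨q', hq'⟩ := g.exists_rightNb hqn
    have hedge : (x : ℝ × ℝ) ∈ openEdge (g.centre q) (g.centre q') g.ℓ := by
      rw [g.openEdge_eq_openRightEdge hq']; exact ⟨hx1, hx2⟩
    by_cases hr : D.roof q
    · have hf : ¬ D.roof q' := (D.checker q q' (Or.inl hq')).1 hr
      obtain ⟨T, E⟩ := D.exists_eData (Or.inl hq') hr hf
      exact ⟨_, Or.inr (Or.inr ⟨q, q', T, Or.inl hq', hr, hf, E, rfl⟩), E.openEdge_subset_source hedge⟩
    · have hn' : g.EdgeNb q' q := Or.inr (Or.inl hq')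
      have hr' : D.roof q' := by
        by_contra h; exact hr ((D.checker q' q hn').not_left.1 h |> fun h' ↦ by tauto)
      obtain ⟨T, E⟩ := D.exists_eData hn' hr' hr
      refine ⟨_, Or.inr (Or.inr ⟨q', q, T, hn', hr', hr, E, rfl⟩), E.openEdge_subset_source ?_⟩
      rwa [openEdge_comm]
  · -- open top edge of `q`, top neighbour `q'`
    obtain ⟨q', hq'⟩ := g.exists_topNb hqn
    have hedge : (x : ℝ × ℝ) ∈ openEdge (g.centre q) (g.centre q') g.ℓ := by
      rw [g.openEdge_eq_openTopEdge hq']; exact ⟨hx1, hx2⟩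
    by_cases hr : D.roof q
    · have hf : ¬ D.roof q' := (D.checker q q' (Or.inr (Or.inr (Or.inl hq')))).1 hr
      obtain ⟨T, E⟩ := D.exists_eData (Or.inr (Or.inr (Or.inl hq'))) hr hf
      exact ⟨_, Or.inr (Or.inr ⟨q, q', T, Or.inr (Or.inr (Or.inl hq')), hr, hf, E, rfl⟩), E.openEdge_subset_source hedge⟩
    · have hn' : g.EdgeNb q' q := Or.inr (Or.inr (Or.inr hq'))
      have hr' : D.roof q' := by
        by_contra h
        have := (D.checker q' q hn')
        tauto
      obtain ⟨T, E⟩ := D.exists_eData hn' hr' hr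
      refine ⟨_, Or.inr (Or.inr ⟨q', q, T, hn', hr', hr, E, rfl⟩), E.openEdge_subset_source ?_⟩
      rwa [openEdge_comm]
  · exact absurd hv hxv

/-- **Monotone transitions.** [folklore] -/
theorem mono (c : OpenPartialHomeomorph g.X₀ (ℝ × ℝ)) (hc : c ∈ D.charts) (c' : OpenPartialHomeomorph g.X₀ (ℝ × ℝ))
    (hc' : c' ∈ D.charts) (x : g.X₀) (hx : x ∈ c.source ∩ c'.source) :
    ∃ U ∈ 𝓝 x, ∀ y ∈ U ∩ (c.source ∩ c'.source), ∀ z ∈ U ∩ (c.source ∩ c'.source), (c y).2 < (c z).2 → (c' y).2 < (c' z).2 := by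
  classical
  haveI := g.nonempty_X₀
  obtain ⟨ĉ, hĉ, rfl⟩ := hc
  obtain ⟨ĉ', hĉ', rfl⟩ := hc'
  rw [OpenPartialHomeomorph.subtypeRestr_source, OpenPartialHomeomorph.subtypeRestr_source] at hx ⊢
  simp only [OpenPartialHomeomorph.subtypeRestr_coe]  -- may or may not be needed
  by_cases hball : ∃ q, (x : ℝ × ℝ) ∈ ball (g.centre q) g.ℓ
  · obtain ⟨q, hq⟩ := hball
    obtain ⟨φ, hφ, hrep⟩ := D.rep hĉ q
    obtain ⟨φ', hφ', hrep'⟩ := D.rep hĉ' q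
    refine ⟨Subtype.val ⁻¹' ball (g.centre q) g.ℓ, (isOpen_ball.preimage continuous_subtype_val).mem_nhds hq,
      fun y hy z hz h ↦ ?_⟩
    have ey := hrep y ⟨hy.2.1, hy.1⟩
    have ez := hrep z ⟨hz.2.1, hz.1⟩
    have ey' := hrep' y ⟨hy.2.2, hy.1⟩
    have ez' := hrep' z ⟨hz.2.2, hz.1⟩
    change (ĉ y).2 < (ĉ z).2 at h
    change (ĉ' y).2 < (ĉ' z).2
    rw [ey, ez] at h
    rw [ey', ez']
    exact hφ' (hφ.lt_iff_lt.1 h)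
  · push Not at hball
    obtain ⟨q₁, q₂, T, hn, hr, hf, E, rfl, he⟩ := D.edge_of_not_mem_ball hĉ hx.1 hball
    obtain ⟨q₃, q₄, T', hn', hr', hf', E', rfl, he'⟩ := D.edge_of_not_mem_ball hĉ' hx.2 hball
    obtain ⟨e1, e2⟩ := D.pair_unique hn hn' hr hf' he he'
    subst e1; subst e2
    refine ⟨univ, univ_mem, fun y hy z hz h ↦ ?_⟩
    change (E.chart y).2 < (E.chart z).2 at h
    change (E'.chart y).2 < (E'.chart z).2
    rw [E.chart_snd_eq_canonHt hy.2.1, E.chart_snd_eq_canonHt hz.2.1] at h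
    rw [E'.chart_snd_eq_canonHt hy.2.2, E'.chart_snd_eq_canonHt hz.2.2]
    exact h

/-- **The pre-atlas of the checkerboard datum.** [folklore] -/
def preAtlas : PreAtlas g.X₀ where
  charts := D.charts
  cover := D.cover
  mono := D.mono

/-- **The contour foliation of the checkerboard datum** on the carrier `X₀`. [folklore] -/
def foliation : Foliation ℝ g.X₀ := D.preAtlas.toFoliation

/-- **The contour foliation is transversely oriented.** [folklore] -/
theorem isTransverselyOriented_foliation : D.foliation.IsTransverselyOriented :=
  PreAtlas.isTransverselyOriented_toFoliation D.preAtlas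

end CheckerboardDatum

end Literature.Topology.FourManifolds
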